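import Literature.NumberTheory.Automorphic.IdeleClassTateNakayamaInflationVanishing
import Literature.NumberTheory.GaloisRepresentations.ChebotarevCyclicProofs
import HarnessLib

/-!
# Milne I Lemma 1.9 (b) for the idèle class formation, colimit form at finite layers: EVERY class
# of `H^r(Gal(E/F), C_E ⊗ N)`, `r ≥ 3`, DIES in the cyclotomic layer `E(ζ_ℓ)` for a suitable prime `ℓ`

Topic `NumberTheory/Automorphic` (idèles, idèle classes); namespace
`Literature.NumberTheory.Automorphic.IdeleClassGroup`.  Theorems only (no definition, no named fact, no
instance).  Sequel of `IdeleClassTateNakayamaInflationVanishing` (door-c6 g11: `[E:F] ∣ [M:E]` ⟹ the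
inflation `Hⁿ⁺³(Gal(E/F), C_E ⊗ N) → Hⁿ⁺³(Gal(M/F), C_M ⊗ Res N)` vanishes) and of the tree's
`ChebotarevCyclicProofs` (`exists_prime_dvd_finrank_cyclotomicField`: a prime `ℓ` with `m ∣ [E(ζ_ℓ) : E]`,
Dirichlet; `isGalois_cyclotomicField_of_isGalois`: `E(ζ_ℓ)/F` is Galois when `E/F` is).

J. S. Milne, *Arithmetic Duality Theorems* (2006), I Lemma 1.9: for a class formation `(G, C)` and a
torsion-free `M`, `Ext^r_G(M, C) = 0` for `r ≥ 3` — i.e. `lim→_U H^r(G/U, Hom(M, C^U)) = 0`, each class being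
killed by a transition map `(U:V)·Inf` with `(G:U) ∣ (U:V)` ("the order of `U` is divisible by all integers",
Harari Remark 16.3).  For the idèle class formation of a number field `F` (Harari Example 16.5 (c)) the
layers are the finite Galois `E/F` and the needed deeper layer is CYCLOTOMIC:

* **`exists_cyclotomicField_map_tensor_eq_zero`** — for every finite Galois extension `E/F` of number
  fields there is a prime `ℓ` such that, with `M = E(ζ_ℓ) = CyclotomicField ℓ E` (a number field, Galois
  over `F`) and the base change `ι : Res C_E → C_M`, for EVERY torsion-free `Gal(E/F)`-module `N` and
  every `n`, the inflation `Hⁿ⁺³(Gal(E/F), C_E ⊗ N) → Hⁿ⁺³(Gal(M/F), C_M ⊗ Res N)` is identically zero.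
  (`ℓ` with `[E:F] ∣ [M:E]`; if `[E:F] = 1` the source group is already `0`.)

So, once `H^r(Γ_F, N ⊗ C̄) = lim→_E H^r(Gal(E/F), C_E ⊗ N)` is available (continuous cohomology of the
discrete `Γ_F`-module `C̄ = lim→ C_E` as a colimit — door-c4's comparison (d)), `H^r(Γ_F, N ⊗ C̄) = 0` for
`r ≥ 3` and every `Γ_F`-lattice `N`, which is Lemma 1.9 (b) / the input `Ext^r_{Γ_F}(N^∨, C̄) = 0` of Tate's
duality theorem (Milne I Thm. 1.8) on Route A to Poitou–Tate (cell bsd-schneider-ideate,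
FINDING-door-c6-g11-allplaces (A5)).  HONEST FRAMING: classical; nothing here bears on BSD.

## References
* J. S. Milne, *Arithmetic Duality Theorems*, 2nd ed. (2006), I Lemma 1.9. [MilneADT2006]
* D. Harari, *Galois Cohomology and Class Field Theory* (2020), Remark 16.3, Example 16.5 (c), Lemma 16.20.
  [Harari2020]
-/

noncomputable section

open NumberField CategoryTheory CategoryTheory.Limits MonoidalCategory groupCohomology
open scoped NumberField

namespace Literature.NumberTheory.Automorphic

namespace IdeleClassGroup

open Literature.NumberTheory.GaloisRepresentations Literature.Algebra.Homology

/-- **Milne I Lemma 1.9 (b), idèle classes, colimit form: every class of `Hⁿ⁺³(Gal(E/F), C_E ⊗ N)` dies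
in a cyclotomic layer.**  For a finite Galois extension `E/F` of number fields there is a prime `ℓ` such
that for `M = CyclotomicField ℓ E = E(ζ_ℓ)` (a number field, Galois over `F` when `E ≠ F`) and the base
change `ι : Res C_E → C_M` (`[x] ↦ [x_M]`), the inflation
`Hⁿ⁺³(Gal(E/F), C_E ⊗ N) → Hⁿ⁺³(Gal(M/F), C_M ⊗ Res N)` is ZERO for every torsion-free `Gal(E/F)`-module
`N` and every `n`: take `ℓ` with `[E:F] ∣ [M:E]` (`exists_prime_dvd_finrank_cyclotomicField`, Dirichlet)
and apply `map_tensor_eq_zero_of_finrank_dvd` (Tate–Nakayama as a cup product + `Inf u_E = [M:E]·u_M`);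
when `[E:F] = 1` the group `Hⁿ⁺³(Gal(E/F), ·)` is already `0`.
[cite: MilneADT2006, Ch. I, Lemma 1.9] [cite: Harari2020, Remark 16.3 and Lemma 16.20] -/
theorem exists_cyclotomicField_map_tensor_eq_zero (F E : Type) [Field F] [NumberField F] [Field E]
    [NumberField E] [Algebra F E] [IsGalois F E] :
    ∃ ℓ : ℕ, ∃ _ : NeZero ℓ, ℓ.Prime ∧
      haveI : NumberField (CyclotomicField ℓ E) :=
        IsCyclotomicExtension.numberField {ℓ} E (CyclotomicField ℓ E)
      ∃ ι : Rep.res (AlgEquiv.restrictNormalHom (F := F) (K₁ := CyclotomicField ℓ E) E) (galoisRep F E) ⟶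
          galoisRep F (CyclotomicField ℓ E),
        (∀ a, ι.hom a = Additive.ofMul (classBaseChange E (CyclotomicField ℓ E)
          (Additive.toMul (α := IdeleClassGroup E) a))) ∧
        ∀ (N : Rep.{0} ℤ (E ≃ₐ[F] E)) [IsAddTorsionFree N.V] (n : ℕ)
          (y : groupCohomology (galoisRep F E ⊗ N) (n + 3)),
          groupCohomology.map (AlgEquiv.restrictNormalHom (F := F) (K₁ := CyclotomicField ℓ E) E)
            (resTensorHom (galoisRep F E) N
                (AlgEquiv.restrictNormalHom (F := F) (K₁ := CyclotomicField ℓ E) E) ≫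
              (ι ⊗ₘ 𝟙 (Rep.res (AlgEquiv.restrictNormalHom (F := F) (K₁ := CyclotomicField ℓ E) E) N)))
            (n + 3) y = 0 := by
  -- a prime `ℓ` with `[E:F] ∣ [E(ζ_ℓ):E]`
  obtain ⟨ℓ, hℓp, -, hdvd⟩ := exists_prime_dvd_finrank_cyclotomicField E
    (n := Module.finrank F E) Module.finrank_pos.ne'
  haveI : NeZero ℓ := ⟨hℓp.ne_zero⟩
  haveI : NumberField (CyclotomicField ℓ E) :=
    IsCyclotomicExtension.numberField {ℓ} E (CyclotomicField ℓ E)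
  obtain ⟨ι, hι⟩ := exists_baseChangeHom (F := F) (E := E) (M := CyclotomicField ℓ E)
  refine ⟨ℓ, inferInstance, hℓp, ι, hι, fun N _ n y => ?_⟩
  by_cases hE : 1 < Module.finrank F E
  · haveI : IsGalois F (CyclotomicField ℓ E) := isGalois_cyclotomicField_of_isGalois ℓ hE
    obtain ⟨φE, φM, hEcm, -, hcompat⟩ :=
      exists_isClassModule_pair_map_eq_finrank_smul (F := F) (E := E) (M := CyclotomicField ℓ E) ι hι
    exact map_tensor_eq_zero_of_finrank_dvd ι hEcm hcompat hdvd N n y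
  · -- `[E:F] = 1`: `Gal(E/F)` is trivial and `Hⁿ⁺³(Gal(E/F), ·) = 0`
    have h1 : Module.finrank F E = 1 := by
      have h0 : 0 < Module.finrank F E := Module.finrank_pos
      omega
    have hy : y = 0 := by
      have h := card_smul_eq_zero_groupCohomology_succ (galoisRep F E ⊗ N) (n + 2) y
      rwa [IsGalois.card_aut_eq_finrank, h1, one_smul] at h
    rw [hy, map_zero]

end IdeleClassGroup

end Literature.NumberTheory.Automorphic

end
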